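import Summits.Ventures.HSemireg.Pad4FirstOrderModelBlockCalculus

/-!
# Venture HSemireg — THEOREM L^ζ step S3: READING THE COLUMN OF THE TOP FLAG ((D), (R1), (R2) in the first-order model;
# companion of `Pad4FirstOrderModel.lean`, row 716; TIER-2 step S3 over S2c `TopFlag` and the block calculus S3a)

HONEST FRAMING. PROVED statements about the first-order MODEL of the PAD-4 anchor (seat s4-prove-1 g24, TRACK S4-PUSH lane
(ii), 2026-08-27). `TheoremLZetaMain` ∕ `TheoremLZeta` (p505821) stay kernel-OPEN (`@[conjecture]`); nothing here proves them.
WHAT IS PROVED. For a top flag `X = N i = a ℓ^{(σ)} + h ℓ_ζ^{(f)}` (S2c) and ONE solution `η` of `X`'s column of (E1) at the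
Weil direction `κ₀ = E_{fσ}`, write `v_j(x, y) := η_j` at the component `qPair σ f`, σ-index `x ∈ R_a^*`, f-index `y`, and
`u_j(x) := v_j(x, ē_B) − ζ̄ v_j(x, ē_A)` (the `w_ζ`-image). Then (`column_reading`):
(D) the diagonal row: `Σ_{Q₀-copies j} Σ_x u_j(x) φ_{X j}(x) = ± a` (S1's `w_ζ`-image of the demand; only copies of `Q₀`
feed it: S2a's contributor lemma, `Minimal`, (F1) `noP`);
(R1) the row of every f-SERVER `S = s ℓ_ζ^{(f)}`, `s > h`, on the block `R_a^* ⊗ R_{s−h} (⊗ W)`: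
`Σ_{Q₀-copies j} u_j(x) φ_{S j}(o) + Σ_{companions C = c ℓ_ζ^{(f)}, h < c < s} Σ_{ι', a'} mulCoef(ι', a', o) v_C(x, ι') φ_{S C}(a') = 0`
(pure-f `P`'s below `h` do not reach this block: `e > d`; `c = s` is excluded by `Minimal`);
(R2) the row of every FLAG `X' = a' ℓ_{ζ'}^{(τ)} + h ℓ_ζ^{(f)}` on a third axis `τ ∉ {σ, f}`, on the block
`R_a^* ⊗ V_f ⊗ R_{a'}` after `w_ζ` on the f-index: `Σ_{Q₀-copies j} u_j(x) φ_{X' j}(o) = 0` (pure pairs below `h` on `f`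
feed `ξ̄_ζ`, killed by `w_ζ`; τ-partners of `X'` are `≥ 2`-charged at height `h`, excluded by (F1); `X'`'s class by
`Minimal`). These are PAD4-THEOREM-L §2 (D_X) ∕ (R1) ∕ (R2) in the kernel, all three with the SAME `u_j` (the pencil's
point that makes THE END work). THE END (the `E₊`-criterion at a copy of `Q₀`, direction `E_{τf}`) is NOT in this file.
No variety, sheaf or semiregularity map is constructed; nothing here says HC ∕ HC_CM ∕ HC_AV holds; no fact, no instance,
no notation; definitions: the class predicates `TopFlag.IsQ0 ∕ IsComp ∕ IsServer ∕ IsFlagOn` and the index sets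
`TopFlag.q0Set ∕ compSet` (classical `Finset.filter`s). REUSE: rows 716, 731, 739, 781 (S1), S2a, S2c, S3a.
FRAMING OF RECORD (director-hodge g10, cell INBOX l.31483 (a)): everything in this file is a theorem of the finite-dimensional
FIRST-ORDER MODEL of row 716 (`Pad4FirstOrderModel.lean`) and of nothing else; the model-to-sheaf bridge (Buchweitz–Flenner 2003)
is NOT in the tree; the cell's (S3) ∕ (S5) STATUS WORDS do not move; no object is certified; nothing here bears on HC ∕ HC_CM ∕
HC_AV ∕ W₆ or on `stub_rung_pad4_seedAt`.
Typed ≠ proved ≠ endorsed.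
-/

noncomputable section
namespace Summit.Ventures.HSemireg.Pad4FirstOrder
open Finset

/-! ## Class predicates around a top flag -/
namespace TopFlag
variable {D : Design} {φ : D.Sections} (T : TopFlag D φ)

/-- `P j` is a COPY OF `Q₀ = h ℓ_ζ^{(f)}`: uncharged on `σ`, the flag's letters on every other factor. -/
def IsQ0 (j : Fin D.nP) : Prop :=
  (D.P j).charge T.σ = 0 ∧ ∀ g, g ≠ T.σ → rel (D.N T.i) (D.P j) g = Rel.zero

/-- `P j` is a COMPANION `C = c ℓ_ζ^{(f)}` with `c > h` (pure-f, the flag's layer and f-phase). -/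
def IsComp (j : Fin D.nP) : Prop :=
  (D.P j).layer = (D.N T.i).layer ∧ (D.P j).phase T.f = (D.N T.i).phase T.f ∧
    (D.N T.i).charge T.f < (D.P j).charge T.f ∧ ∀ g, g ≠ T.f → (D.P j).charge g = 0

/-- `N r` is an f-SERVER `S = s ℓ_ζ^{(f)}`, `s > h` (pure-f, the flag's layer and f-phase). -/
def IsServer (r : Fin D.nN) : Prop :=
  (D.N r).layer = (D.N T.i).layer ∧ (D.N r).phase T.f = (D.N T.i).phase T.f ∧
    (D.N T.i).charge T.f < (D.N r).charge T.f ∧ ∀ g, g ≠ T.f → (D.N r).charge g = 0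

/-- `N r` is a FLAG AT HEIGHT `h` ON THE AXIS `τ`: `a' ℓ_{ζ'}^{(τ)} + h ℓ_ζ^{(f)}` in the flag's layer (any `a' ≥ 1`, any `ζ'`). -/
def IsFlagOn (τ : Fin 4) (r : Fin D.nN) : Prop :=
  (D.N r).layer = (D.N T.i).layer ∧ (D.N r).phase T.f = (D.N T.i).phase T.f ∧
    (D.N r).charge T.f = (D.N T.i).charge T.f ∧ (D.N r).charge τ ≠ 0 ∧ ∀ g, g ≠ τ → g ≠ T.f → (D.N r).charge g = 0

/-- the indices of the copies of `Q₀`. -/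
def q0Set : Finset (Fin D.nP) := by classical exact univ.filter fun j => T.IsQ0 j

/-- the indices of the companions `C = c ℓ_ζ^{(f)}` with `h < c < s`. -/
def compSet (s : ℕ) : Finset (Fin D.nP) := by
  classical exact univ.filter fun j => T.IsComp j ∧ (D.P j).charge T.f < s

end TopFlag

/-! ## Generic: one term of a row, restricted to a block -/

/-- `qPair σ f σ = 1`. -/
theorem qPair_left (σ f : Fin 4) : qPair σ f σ = 1 := by simp [qPair]

/-- the `j`-th (resp. `i`-th) term of `lowerLHS` (resp. `upperLHS`) at `(q, o)`, with the unknown index restricted to the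
block of `q`: `Σ_{o' ∈ block} (Σ_a coefProd · φ(a)) · η(q, o')`. -/
theorem term_restrict (Y X R S' : Constituent) (q : Fin 4 → ℕ) (hq : q ∈ qDist2) (o : Fin 4 → ℕ × ℕ)
    (φ' : (Fin 4 → ℕ × ℕ) → ℂ) (η' : (Fin 4 → ℕ) → (Fin 4 → ℕ × ℕ) → ℂ) :
    ∑ u ∈ idxH2 Y X, ∑ a ∈ idxH0 R S',
        (if u.1 = q then coefProd (rel Y X) (rel R S') q u.2 a o else 0) * φ' a * η' u.1 u.2 =
      ∑ o' ∈ Fintype.piFinset (fun g => idx (rel Y X g) (q g)),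
        (∑ a ∈ idxH0 R S', coefProd (rel Y X) (rel R S') q o' a o * φ' a) * η' q o' := by
  rw [← sum_idxH2_ite Y X q hq (fun u1 o' => (∑ a ∈ idxH0 R S', coefProd (rel Y X) (rel R S') q o' a o * φ' a) * η' u1 o')]
  refine Finset.sum_congr rfl fun u _ => ?_
  split_ifs with h
  · simp only [Finset.sum_mul, h]
  · simp

/-! ## (D): the diagonal row is fed by the copies of `Q₀` only -/

section Reading
variable {D : Design} {φ : D.Sections} (T : TopFlag D φ)

/-- a copy of `Q₀` against the flag, per factor: `Q₀ − X = −a ℓ^{(σ)}`, `X − Q₀ = +a ℓ^{(σ)}`, class `0` off `σ`. -/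
theorem TopFlag.isQ0_rel {j : Fin D.nP} (hj : T.IsQ0 j) :
    rel (D.P j) (D.N T.i) T.σ = Rel.neg ((D.N T.i).charge T.σ) ((D.N T.i).phase T.σ) ∧
    rel (D.N T.i) (D.P j) T.σ = Rel.pos ((D.N T.i).charge T.σ) ((D.N T.i).phase T.σ) ∧
    (∀ g, g ≠ T.σ → rel (D.P j) (D.N T.i) g = Rel.zero) ∧ (∀ g, g ≠ T.σ → rel (D.N T.i) (D.P j) g = Rel.zero) := by
  have hQl := (topFlag_Q0 D φ T j hj).1
  exact ⟨rel_uncharged_charged _ _ T.σ hQl hj.1 T.flag_σ, rel_charged_uncharged _ _ T.σ hQl hj.1 T.flag_σ,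
    fun g hg => rel_zero_symm _ _ g (hj.2 g hg), hj.2⟩

/-- (D), a copy of `Q₀`: its term of the diagonal row at `(qPair σ f, [f ↦ y])`, `y ∈ {ē_A, ē_B}`, is
`Σ_{x ∈ R_a} φ_{X j}(x) · η_j(qPair σ f, [σ ↦ x, f ↦ y])` (evaluation pairing on `σ` read at `ē_{A,σ}`, identity on `V_f`). -/
theorem diag_term_isQ0 (η : Fin D.nP → (Fin 4 → ℕ) → (Fin 4 → ℕ × ℕ) → ℂ) {j : Fin D.nP} (hj : T.IsQ0 j)
    (y : ℕ × ℕ) (hy : y = (0, 0) ∨ y = (1, 0)) :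
    ∑ u ∈ idxH2 (D.P j) (D.N T.i), ∑ a ∈ idxH0 (D.N T.i) (D.P j),
        (if u.1 = qPair T.σ T.f then coefProd (rel (D.P j) (D.N T.i)) (rel (D.N T.i) (D.P j)) (qPair T.σ T.f) u.2 a
          (Function.update (fun _ => ((0 : ℕ), (0 : ℕ))) T.f y) else 0) * φ T.i j a * η j u.1 u.2 =
      ∑ x ∈ monIdx ((D.N T.i).charge T.σ), φ T.i j (Function.update (fun _ => ((0 : ℕ), (0 : ℕ))) T.σ x) *
        η j (qPair T.σ T.f) (Function.update (Function.update (fun _ => ((0 : ℕ), (0 : ℕ))) T.σ x) T.f y) := by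
  obtain ⟨hσU, hσS, hU0, hS0⟩ := T.isQ0_rel hj
  rw [term_restrict _ _ _ _ _ (qPair_mem_qDist2 _ _ T.hσf),
    sum_piFinset_pair _ T.σ T.f T.hσf (fun g hgσ hgf => by rw [hU0 g hgσ, qPair_of_ne hgσ hgf, idx_zero_zero]),
    hσU, qPair_left, idx_neg_one, hU0 T.f T.hσf.symm, qPair_right, idx_zero_one]
  refine Finset.sum_congr rfl fun x hx => ?_
  have hc : ∀ y' z : ℕ × ℕ, coefProd (rel (D.P j) (D.N T.i)) (rel (D.N T.i) (D.P j)) (qPair T.σ T.f)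
      (Function.update (Function.update (fun _ => ((0 : ℕ), (0 : ℕ))) T.σ x) T.f y')
      (Function.update (fun _ => ((0 : ℕ), (0 : ℕ))) T.σ z) (Function.update (fun _ => ((0 : ℕ), (0 : ℕ))) T.f y) =
      (if z = x then 1 else 0) * (if y = y' then 1 else 0) := by
    intro y' z
    rw [coefProd_split2 _ _ _ _ _ _ T.σ T.f T.hσf (fun g hgσ hgf => by
      rw [hS0 g hgσ, coef_zero_right, Function.update_of_ne hgf, update_update_apply_of_ne hgσ hgf, if_pos rfl]),
      hσU, hσS, hS0 T.f T.hσf.symm, qPair_left, qPair_right]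
    simp only [Function.update_self, Function.update_of_ne T.hσf, Function.update_of_ne T.hσf.symm,
      coef_neg_one_pos_self, coef_zero_right, xiBar_A]
  have inner : ∀ y' : ℕ × ℕ, ∑ a ∈ idxH0 (D.N T.i) (D.P j), coefProd (rel (D.P j) (D.N T.i)) (rel (D.N T.i) (D.P j))
      (qPair T.σ T.f) (Function.update (Function.update (fun _ => ((0 : ℕ), (0 : ℕ))) T.σ x) T.f y') a
      (Function.update (fun _ => ((0 : ℕ), (0 : ℕ))) T.f y) * φ T.i j a =
      if y = y' then φ T.i j (Function.update (fun _ => ((0 : ℕ), (0 : ℕ))) T.σ x) else 0 := by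
    intro y'
    unfold idxH0
    rw [sum_piFinset_single _ T.σ (fun g hg => by rw [hS0 g hg, idx_zero_zero]), hσS, idx_pos_zero]
    simp_rw [hc y']
    simp_rw [mul_assoc, ite_mul, one_mul, zero_mul]
    rw [Finset.sum_ite_eq' (monIdx ((D.N T.i).charge T.σ)) x, if_pos hx]
  simp_rw [inner, ite_mul, zero_mul]
  rw [Finset.sum_ite_eq]
  rcases hy with rfl | rfl <;> simp

/-- (D), any other `P j`: the `w_ζ`-combination of its two terms vanishes — by S2a's contributor lemma if some letter off
`σ` differs, by `Minimal` if `P j` has the flag's class, and σ-ray partners charged on `σ` do not exist ((F1) `noP`). -/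
theorem diag_term_not_isQ0 (hmin : D.Minimal φ) (η : Fin D.nP → (Fin 4 → ℕ) → (Fin 4 → ℕ × ℕ) → ℂ) {j : Fin D.nP}
    (hj : ¬ T.IsQ0 j) :
    (∑ u ∈ idxH2 (D.P j) (D.N T.i), ∑ a ∈ idxH0 (D.N T.i) (D.P j),
        (if u.1 = qPair T.σ T.f then coefProd (rel (D.P j) (D.N T.i)) (rel (D.N T.i) (D.P j)) (qPair T.σ T.f) u.2 a
          (Function.update (fun _ => ((0 : ℕ), (0 : ℕ))) T.f (1, 0)) else 0) * φ T.i j a * η j u.1 u.2) -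
      zetaBar ((D.N T.i).phase T.f) *
      (∑ u ∈ idxH2 (D.P j) (D.N T.i), ∑ a ∈ idxH0 (D.N T.i) (D.P j),
        (if u.1 = qPair T.σ T.f then coefProd (rel (D.P j) (D.N T.i)) (rel (D.N T.i) (D.P j)) (qPair T.σ T.f) u.2 a
          (Function.update (fun _ => ((0 : ℕ), (0 : ℕ))) T.f (0, 0)) else 0) * φ T.i j a * η j u.1 u.2) = 0 := by
  rw [Finset.mul_sum, ← Finset.sum_sub_distrib]
  refine Finset.sum_eq_zero fun u hu => ?_
  rw [Finset.mul_sum, ← Finset.sum_sub_distrib]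
  refine Finset.sum_eq_zero fun a ha => ?_
  by_cases hu1 : u.1 = qPair T.σ T.f
  swap
  · rw [if_neg hu1, if_neg hu1]; ring
  rw [if_pos hu1, if_pos hu1]
  by_cases hoff : ∃ g₁, g₁ ≠ T.σ ∧ rel (D.N T.i) (D.P j) g₁ ≠ Rel.zero
  · obtain ⟨g₁, hg₁, hne⟩ := hoff
    have hc := coefProd_wImage_eq_zero (D.N T.i) (D.P j) T.σ T.f T.hσf u hu hu1 a ha g₁ hg₁ hne
    linear_combination (φ T.i j a * η j u.1 u.2) * hc
  · push Not at hoff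
    by_cases hσ0 : rel (D.N T.i) (D.P j) T.σ = Rel.zero
    · have hall : ∀ g, rel (D.N T.i) (D.P j) g = Rel.zero := fun g => by
        by_cases hg : g = T.σ
        · rw [hg]; exact hσ0
        · exact hoff g hg
      rw [hmin T.i j hall a]; ring
    · -- a strict σ-ray partner charged on `σ`: `≥ 2`-charged at height `h`, excluded by (F1)
      exfalso
      have hag : (idx (rel (D.N T.i) (D.P j) T.σ) 0).Nonempty := ⟨a T.σ, (mem_idxH0_iff _ _ a).1 ha T.σ⟩
      rcases rel_eq_of_idx_zero_nonempty _ _ T.σ hag with ⟨hz, -, -⟩ | ⟨-, hlt, hph⟩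
      · exact hσ0 hz
      by_cases hc0 : (D.P j).charge T.σ = 0
      · exact hj ⟨hc0, hoff⟩
      · have hPf : (D.P j).charge T.f = (D.N T.i).charge T.f := (of_rel_zero _ _ _ (hoff T.f T.hσf.symm)).2.1.symm
        have := T.noP j (two_le_nCharged _ T.σ T.f T.hσf hc0 (by rw [hPf]; exact T.flag_f))
        omega

/-- **(D) THE DIAGONAL ROW READ**: for a solution `η` of `X`'s column at `κ₀ = E_{fσ}`, the `w_ζ`-image of the demand row,
`± a ≠ 0` (S1), equals `Σ_{copies j of Q₀} Σ_{x ∈ R_a} u_j(x) φ_{X j}(x)`. -/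
theorem column_reading_D (hmin : D.Minimal φ) (η : Fin D.nP → (Fin 4 → ℕ) → (Fin 4 → ℕ × ℕ) → ℂ)
    (hη : ∀ r, ∀ t ∈ idxH2 (D.N r) (D.N T.i), D.lowerLHS φ η T.i r t =
      if r = T.i then ob (D.N T.i) (Matrix.of fun a b => if a = T.f ∧ b = T.σ then (1 : ℂ) else 0) t.1 t.2 else 0) :
    ∑ j ∈ T.q0Set, ∑ x ∈ monIdx ((D.N T.i).charge T.σ),
        (η j (qPair T.σ T.f) (Function.update (Function.update (fun _ => ((0 : ℕ), (0 : ℕ))) T.σ x) T.f (1, 0)) -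
          zetaBar ((D.N T.i).phase T.f) *
            η j (qPair T.σ T.f) (Function.update (Function.update (fun _ => ((0 : ℕ), (0 : ℕ))) T.σ x) T.f (0, 0))) *
        φ T.i j (Function.update (fun _ => ((0 : ℕ), (0 : ℕ))) T.σ x) =
      (if T.σ < T.f then 1 else -1) * ((D.N T.i).charge T.σ : ℂ) := by
  classical
  have hoB : (qPair T.σ T.f, Function.update (fun _ => ((0 : ℕ), (0 : ℕ))) T.f (1, 0)) ∈ idxH2 (D.N T.i) (D.N T.i) :=
    mem_idxH2_self_qPair _ T.σ T.f T.hσf _ fun g => by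
      by_cases hg : g = T.f
      · subst hg; exact Or.inr ⟨Function.update_self .., Or.inr rfl⟩
      · exact Or.inl (Function.update_of_ne hg ..)
  have hoA : (qPair T.σ T.f, Function.update (fun _ => ((0 : ℕ), (0 : ℕ))) T.f (0, 0)) ∈ idxH2 (D.N T.i) (D.N T.i) :=
    mem_idxH2_self_qPair _ T.σ T.f T.hσf _ fun g => Or.inl (by
      by_cases hg : g = T.f
      · subst hg; exact Function.update_self ..
      · exact Function.update_of_ne hg ..)
  have eB := hη T.i _ hoB
  have eA := hη T.i _ hoA
  rw [if_pos rfl] at eB eA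
  have key := ob_qPair_wImage_E_A (D.N T.i) T.σ T.f T.hσf (fun _ => ((0 : ℕ), (0 : ℕ))) rfl
  rw [← eB, ← eA] at key
  rw [← key]
  simp only [Design.lowerLHS]
  rw [Finset.mul_sum, ← Finset.sum_sub_distrib]
  -- per `j`: copies of `Q₀` give `Σ_x u_j(x) φ(x)`, the others `0`
  rw [← Finset.sum_filter_add_sum_filter_not univ (fun j => T.IsQ0 j)]
  rw [Finset.sum_eq_zero (s := univ.filter fun j => ¬ T.IsQ0 j) (fun j hj =>
    diag_term_not_isQ0 T hmin η (mem_filter.1 hj).2), add_zero]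
  unfold TopFlag.q0Set
  refine Finset.sum_congr rfl fun j hj => ?_
  have hj' : T.IsQ0 j := (mem_filter.1 hj).2
  rw [diag_term_isQ0 T η hj' (1, 0) (Or.inr rfl), diag_term_isQ0 T η hj' (0, 0) (Or.inl rfl),
    Finset.mul_sum, ← Finset.sum_sub_distrib]
  refine Finset.sum_congr rfl fun x _ => ?_
  ring

end Reading

end Summit.Ventures.HSemireg.Pad4FirstOrder
end
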